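import Literature.MathematicalPhysics.QuantumFieldTheory.Balaban1983to89.B6Cov2156TorusDelK
import Literature.MathematicalPhysics.QuantumFieldTheory.Balaban1983to89.B1Eq324BenfattoClassTorusWindow
import Literature.MathematicalPhysics.QuantumFieldTheory.Balaban1983to89.B1Eq324BenfattoKernelEq324AnyGammaUnitRange
import HarnessLib

/-!
# `Balaban1983to89.B1Eq324BenfattoClassTorusGaugeFluctuation` — THE THIRD CAPSTONE INSTANCE of the class road, AT THE GAUGE FIELD:
# [Balaban1982Higgs1] (3.24) for the Gaussian field of [Balaban1984PropagatorsII] (2.155)'s fluctuation precision `C*Δ_kC` — the pure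
# gauge-field fluctuation operator of the `k`-th renormalization step on the unit torus `T^{(k)}` at ZERO BACKGROUND (`U = 1`), in the
# remaining bond variables `B′` — EVERY dimension `d ≥ 2`, EVERY block size `L`, EVERY cubic torus `(ℤ/N)^d` (`L ∣ N`), EVERY level `n = L^k`,
# EVERY coupling `η ∈ (0,1]` — UNCONDITIONAL, no definition

statement-level companion of a published source with citation tags; every declaration here is a theorem; nothing here is
a claim about the Yang–Mills mass gap

WHY THIS MODULE (cell `pub-ymgap`, seat `dag-n08-d` gen 16, CLAIM-75; node N08 [Balaban1985UV3]; the [BenfattoEtAl1978] source chain behind the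
(α)-row `h324`).  The class road (≈ 60 modules; seats n08-b / n08-c / n08-d / n08-w4 / n08-w5) proves [Balaban1982Higgs1] (3.24) for the Gaussian
field of every CLASS MEMBER — a finite window `Λ ⊂ ℤ^D`, a symmetric uniformly elliptic precision with exponentially decaying entries — with the
member data as HYPOTHESES; seat n08-b's bent window (`…ClassTorusWindow.exists_presentation_of_torusDecay`) places any finite family of variables
sitting over a discrete torus `(ℤ/N)^d` (with finitely many labels per site) on a window of `ℤ^{d+d+1}` so that torus-distance decay becomes
Euclidean decay.  The two capstone instances so far: the massive free field on the torus (n08-b `…ClassTorusLaplacian`) and the scalar-sector box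
fluctuation covariance of [Balaban1983RegularityDecay] (1.13) at zero background (this seat's `…ClassBoxFluctuation`).  THIS FILE runs the road on the
object closest to [Balaban1985UV3]'s own member that the tree holds hypothesis-free: the GAUGE-FIELD fluctuation precision of
[Balaban1984PropagatorsII] pp. 249–250 — «Doing a k + 1 renormalization transformation we have to calculate an integral of the form
const ∫dB δ(QB) δ_{Ax}(B) e^{−½⟨B,Δ_kB⟩} F(B) (2.152) on the whole lattice T^{(k)} … we can write B = CB′ … = (L^d)^{|Λ′|} ∫dB′
e^{−½⟨B′,C*Δ_kCB′⟩+⟨C*J,B′⟩} … (2.155) … ⟨B′, C*Δ_kCB′⟩ ≥ (γ₀/12d²)L^{−d−1}‖CB′‖² ≥ γ′₀‖B′‖² (2.157) … C is a short-ranged operator, so C*Δ_kC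
has the same exponential decay as Δ_k» — at the trivial background `U = 1`, which is the situation of [Balaban1985UV3] (22)/(58) at the trivial
background and trivial history.  The `pub-balaban` lineage pv09/b05/β certified all of it with NO residual hypothesis on the torus
(`B6Cov2156TorusDelK`: `reDelK n hn M` = `Re Δ_k` of the genuine (1.65) operator in the bond basis of the box of representatives (and `Im Δ_k = 0`),
`kernelDecay_reDelK` (entry decay in the periodic distance `ρ_M`, constants from `d` only), `ineq_2157_reDelK_sharp` ((2.157) with
`γ′₀ = (1/12d²)L^{−d−1}`), `B6Cov2156Torus.bondReductionT_printedPer` (the printed-shape inputs for the explicit elimination matrix `C = elimT` of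
p. 250: range `L − 1`, `ℓ¹` sums `≤ L^d + 1`), `B6FromB4.sandwich_isSymm` / `sandwich_decay` («the same exponential decay as Δ_k», with its constant)).
So `S := C*(Re Δ_k)C` on the remaining variables `B′ = freeT L M` IS a class member with constants depending on `(d, L)` ONLY — uniformly in the
torus and in the level `n = L^k` (§2); on a cubic torus the bent window presents it on `ℤ^{d+d+1}` (§3; `site k = k₋ mod N`, `lab k =` direction,
`d` labels); and the road's END applies verbatim (§4).

WHAT IS PROVED (theorems only; no definition, no named fact, no `sorry`; axioms standard).
* §1 glue (private): `sum_mul_mulVec_eq_sum_sum`, `circAbs_le_pdist` (each coordinate circular distance `≤ ρ_M`), `abs_valMinAbs_le_pdist`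
  (`|(k̄₋ − k̄′₋)_i| = circAbs N (k₋ − k′₋)_i ≤ ρ_N(k₋, k′₋)`: the bent window's `hρ`), `siteLab_injective` (a bond of the box of representatives is
  determined by (residue of its base point, direction)).
* §2 ★★ `torusGauge_classMember` — `d ≥ 2`, `L ≥ 1` ⇒ `∃ K_A ≥ 0, κ_A > 0` (from `(d, L)` only) such that for EVERY torus `M` (`L ∣ M_i`) and EVERY
  level `n ≥ 1`: `S = (elimT)ᵀ·(Re Δ_k)·(elimT) : Matrix B′ B′ ℝ` is symmetric, `γ′₀`-coercive in the class binder shape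
  (`γ′₀ Σ_k w_k² ≤ Σ_{k,k′} S_{kk′} w_k w_{k′}`, `γ′₀ = gamma2153one d L = (1/12d²)L^{−d−1}`) and `|S_{kk′}| ≤ K_A e^{−κ_A ρ_M(k₋, k′₋)}`
  (`K_A = c₀e^{2δ₀(L−1)}(L^d+1)²`, `κ_A = δ₀` with `kernelDecay_reDelK`'s `(c₀, δ₀)`).
* §3 ★★★ `torusGauge_presentation` — on the cubic torus `(ℤ/N)^d`, `L ∣ N`: `∃ K_A′ ≥ 0, κ_A′ > 0` (from `(d, L)` only) `∀ N ∀ n ∃ Λ ⊂ ℤ^{d+d+1},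
  e : B′ ≃ Λ`: `reindex e e S` symmetric, `γ′₀`-coercive, `|·| ≤ K_A′ e^{−κ_A′|x−y|₂}` (the three member rows of `eq324_kernel_of_expDecay(_on_unit)`),
  `(μ_K).map (z ↦ z ∘ e) = 𝒩(0, S⁻¹)` (`K` = zero-extended `(reindex e e S)⁻¹`), and the uniform-threshold boxes pull back to `smallFieldSet Λ p` a.e.
* §4 ★★★★ `eq324_torusGaugeFluctuation_on_unit` — `∃ b₁ ∀ b₀ > b₁ ∃ C ≥ 0 ∀ N` (`L ∣ N`, `B′ ≠ ∅`) `∀ n ≥ 1 ∃ Λ e`: the presentation of §3 and,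
  for all `η ∈ (0,1]` and every `(s, J ⊆ I, J ⊆ Λ, 𝔄)` with `I ≠ ∅`, `sup|𝔄| ≤ c·η^σ`:
  `0 < ∫Π_Δχ̂_{I,p(η)}e^{H_J}dμ_K ∧ |log ∫Π_Δχ̂_{I,p(η)}e^{H_J}dμ_K − Σ_{k≤t}𝓔^T(H_J;k)/k!| ≤ C·η^κ·|I|` — seat n08-b's
  `eq324_kernel_of_expDecay_on_unit` conclusion VERBATIM on `ℤ^{d+d+1}`; ★★★ `eq324_torusGaugeFluctuation` — the `η₀`-window edition.
* §5 ★★ `torusGaugeSub_classMember` — the same three rows, SAME constants, for `S_S := C_Sᵀ·(Re Δ_k)·C_S` with `C_S = elimTS L M S hS` the columns of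
  `C` at ANY sub-family `S ⊆ B′` (general torus `M`) — in particular `S = lamFree L M Λ′₀`, the `Λ`-bonds of a region `Λ = B(Λ′₀) ⊂ T^{(k)}`, i.e.
  the precision of (2.152) «on a subset Λ ⊂ T^{(k)}» (`B6Cov2156TorusSubset.bondReductionLam`; over `subFamilyT_printedPer`);
  ★★★★ `eq324_torusGaugeFluctuationSub_on_unit` — the §4 statement for every non-empty sub-family `S` of a cubic torus (presentation of
  `𝒩(0, (C_S*Δ_kC_S)⁻¹)` + the (3.24) pair at every `η ∈ (0,1]`), one `(b₁, C)` for all `N`, `n`, `S`.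
* Non-vacuity `example`s at `d = 3` (window `ℤ^7`), `L = 2`, the d = 3 lane's letters `t = 6`, `D = 4`, `σ = ½`, `κ = 13/4`; and §5's rows at `d = 4`.

HONEST SCOPE / NOT HERE.  A composition BY NAME of certified lineages (`pub-balaban` pv09/b05/β: `B6Cov2156TorusDelK` and its imports; this cell's
class road and bent window); no estimate is re-proved.  The member is the ZERO-BACKGROUND (`U = 1`) gauge-field fluctuation precision of
[Balaban1984PropagatorsII] (2.155) in the remaining variables `B′` (the full covariance `C^{(k)} = C(C*Δ_kC)⁻¹C*` of (2.156) on all bonds is its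
push-forward under `B = CB′`, a degenerate Gaussian — not re-presented here); torus model of that lineage (fine torus over the unit torus, `m² = 0`,
`n = L^k ≥ 1` a free parameter; §2–§4 on the whole torus `Λ = T^{(k)}`, §5 for every sub-family of `B′`, the region reading `Λ = B(Λ′₀)` being
`S = lamFree L M Λ′₀` of `B6Cov2156TorusSubset`); CUBIC tori only in §3–§5's presentations (the bent window of seat n08-b is typed for `(ℤ/N)^d`); `B′ ≠ ∅` is a displayed hypothesis (for `L = 1` every variable is eliminated).  It
is NOT [Balaban1985UV3]'s member at a GENERAL background field (that is N06 [Balaban1985BackgroundPropagators] Sect. E's `C*Δ_kC(U)`, the IDENT's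
member, NOT commissioned, NOT claimed), and NOT the IDENT's class-II letters: which (4.5)-Hamiltonian `H_J` on the window presents
[Balaban1985UV3]'s `𝒱`, and which cut-offs its `χ`, stay the road's generic `hamiltonian s D ϰ 𝔄 J` / `cutoffBoltzmann`; the threshold window
`b₁ < b₀` is displayed, not decided.  Nothing of [Balaban1985UV3] / [Balaban1985UV2] / [BenfattoEtAl1978] is asserted or discharged; `PrintedUV3V`
NOT proved; N08 is NOT discharged by this file; count-neutral; nothing about d = 4 specifically, the continuum, OS axioms, a mass gap or the Clay
problem.
-/

noncomputable section

open MeasureTheory Finset Matrix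
open scoped BigOperators

namespace Literature.MathematicalPhysics.QuantumFieldTheory.Balaban1983to89.B1Eq324BenfattoClassTorusGaugeFluctuation

open Literature.MathematicalPhysics.QuantumFieldTheory
open Literature.MathematicalPhysics.QuantumFieldTheory.Balaban1983to89.B1Eq324BenfattoLemma
open Literature.MathematicalPhysics.QuantumFieldTheory.Balaban1983to89.B6Lemma24Torus (pbox mem_pbox)
open Literature.MathematicalPhysics.QuantumFieldTheory.Balaban1983to89.B6BondEliminationTorus
  (res res_val pdist zdPer PrintedPer ofPer circAbs_res)
open Literature.MathematicalPhysics.QuantumFieldTheory.Balaban1983to89.B6Cov2156Torus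
  (one_le_M freeT elimT bondReductionT bondReductionT_printedPer)
open Literature.MathematicalPhysics.QuantumFieldTheory.Balaban1983to89.B6Cov2156TorusSubset
  (elimTS subFamilyT subFamilyT_printedPer lamFree lamFree_subset)
open Literature.MathematicalPhysics.QuantumFieldTheory.Balaban1983to89.B6Cov2156TorusDelK
  (reDelK reDelK_isSymm kernelDecay_reDelK lowerOnConstrainedT_reDelK_sharp ineq_2157_reDelK_sharp gamma2153one
    gamma2153one_pos)
open Literature.MathematicalPhysics.QuantumFieldTheory.Balaban1983to89.B4TorusKernel.MultiPeriod (circAbs circAbs_nonneg)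
open Literature.MathematicalPhysics.QuantumFieldTheory.Balaban1983to89.B4Sect5Torus (tdist ccoord ccoord_cast)
open Literature.MathematicalPhysics.QuantumFieldTheory.Balaban1983to89.B1Eq324BenfattoClassTorusWindow
  (exists_presentation_of_torusDecay)
open Literature.MathematicalPhysics.QuantumFieldTheory.Balaban1983to89.B1Eq324BenfattoKernelEq324AnyGamma
  (eq324_kernel_of_expDecay)
open Literature.MathematicalPhysics.QuantumFieldTheory.Balaban1983to89.B1Eq324BenfattoKernelEq324AnyGammaUnitRange
  (eq324_kernel_of_expDecay_on_unit)

variable {d L : ℕ}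

/-! ## §1  Glue -/

/-- the class form in two currencies. [folklore] -/
private theorem sum_mul_mulVec_eq_sum_sum {ι : Type*} [Fintype ι] (A : Matrix ι ι ℝ) (v : ι → ℝ) :
    ∑ e, v e * A.mulVec v e = ∑ e, ∑ e', A e e' * v e * v e' := by
  simp only [Matrix.mulVec, dotProduct, Finset.mul_sum]
  exact Finset.sum_congr rfl fun e _ => Finset.sum_congr rfl fun e' _ => by ring

/-- each coordinate circular distance is at most the periodic sup-distance `ρ_M`. [folklore] -/
private theorem circAbs_le_pdist (M : Fin d → ℕ) [∀ μ, NeZero (M μ)] (x y : Fin d → ℤ) (i : Fin d) :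
    ((circAbs (M i) (x i - y i) : ℤ) : ℝ) ≤ pdist M (one_le_M M) x y := by
  have h1 : ccoord M (res M (one_le_M M) x) (res M (one_le_M M) y) i ≤
      Finset.univ.sup (ccoord M (res M (one_le_M M) x) (res M (one_le_M M) y)) :=
    Finset.le_sup (f := ccoord M (res M (one_le_M M) x) (res M (one_le_M M) y)) (Finset.mem_univ i)
  have h2 : ((ccoord M (res M (one_le_M M) x) (res M (one_le_M M) y) i : ℕ) : ℤ) = circAbs (M i) (x i - y i) := by
    rw [ccoord_cast (one_le_M M), circAbs_res]
  unfold pdist tdist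
  calc ((circAbs (M i) (x i - y i) : ℤ) : ℝ)
      = (((ccoord M (res M (one_le_M M) x) (res M (one_le_M M) y) i : ℕ) : ℤ) : ℝ) := by rw [h2]
    _ = ((ccoord M (res M (one_le_M M) x) (res M (one_le_M M) y) i : ℕ) : ℝ) := by norm_cast
    _ ≤ _ := by exact_mod_cast h1

/-- the torus coordinate distance of the residues is the circular distance of the integers:
`|(x̄_i − ȳ_i).valMinAbs| = circAbs N (x_i − y_i)`, hence `≤ ρ_N(x, y)`. [folklore] -/
private theorem abs_valMinAbs_le_pdist (N : ℕ) [NeZero N] (x y : Fin d → ℤ) (i : Fin d) :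
    (|((((x i : ℤ) : ZMod N) - ((y i : ℤ) : ZMod N)).valMinAbs : ℤ)| : ℝ) ≤
      pdist (fun _ : Fin d => N) (one_le_M fun _ : Fin d => N) x y := by
  have hz : (((x i : ℤ) : ZMod N) - ((y i : ℤ) : ZMod N)) = ((x i - y i : ℤ) : ZMod N) := by push_cast; rfl
  have hnat : (((((x i : ℤ) : ZMod N) - ((y i : ℤ) : ZMod N)).valMinAbs.natAbs : ℕ) : ℤ) = circAbs N (x i - y i) := by
    rw [hz, ZMod.valMinAbs_natAbs_eq_min]
    have hv : ((((x i - y i : ℤ) : ZMod N)).val : ℤ) = (x i - y i) % (N : ℤ) := ZMod.val_intCast (x i - y i)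
    have hle : (((x i - y i : ℤ) : ZMod N)).val ≤ N := (ZMod.val_lt _).le
    rw [Nat.cast_min, Nat.cast_sub hle, hv]
    rfl
  have habs : |((((x i : ℤ) : ZMod N) - ((y i : ℤ) : ZMod N)).valMinAbs : ℤ)| = circAbs N (x i - y i) := by
    rw [Int.abs_eq_natAbs, hnat]
  rw [← Int.cast_abs, habs]
  exact circAbs_le_pdist (fun _ : Fin d => N) x y i

/-! ## §2  The member: `C*Δ_kC` on the remaining bond variables of the torus -/

/-- ★★ **THE GAUGE-FIELD FLUCTUATION PRECISION `C*Δ_kC` IS A CLASS MEMBER, UNIFORMLY IN THE TORUS AND THE LEVEL.**  For `d ≥ 2`, `L ≥ 1` there are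
`K_A ≥ 0`, `κ_A > 0` — from `(d, L)` ONLY — such that for EVERY torus `T = ℤ^d/(M₁ℤ × ⋯ × M_dℤ)` with `L ∣ M_i` and EVERY level `n ≥ 1` (`n = L^k`),
the precision `S := Cᵀ·(Re Δ_k)·C` of the Gaussian (2.155) in the remaining bond variables `B′ = freeT L M` (`C = elimT L M` the explicit elimination
matrix of p. 250, `Re Δ_k = reDelK n hn M` the genuine (1.65) operator in the bond basis, real since `Im Δ_k = 0`) is symmetric, `γ′₀`-coercive in the
class binder shape with `γ′₀ = (1/12d²)L^{−d−1}` ((2.157), both inequalities), and has `|S_{kk′}| ≤ K_A e^{−κ_A ρ_M(k₋, k′₋)}` in the periodic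
sup-distance of the base points («C is a short-ranged operator, so C*Δ_kC has the same exponential decay as Δ_k»: `B6FromB4.sandwich_decay` with
`bondReductionT_printedPer`'s range `L − 1` and `ℓ¹` sums `L^d + 1`, over `kernelDecay_reDelK`).
[cite: Balaban1984PropagatorsII, (2.152)–(2.157) pp.249–250; Balaban1984PropagatorsI, (1.65) p.29; Balaban1985BackgroundPropagators, Sect. E p.428
(class form; ours); BenfattoEtAl1978, Appendix C 1) (C.2) p.164 (class form; ours)] -/
theorem torusGauge_classMember (hd : 2 ≤ d) (hL : 1 ≤ L) :
    ∃ KA κA : ℝ, 0 ≤ KA ∧ 0 < κA ∧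
      ∀ (M : Fin d → ℕ) [∀ μ, NeZero (M μ)], (∀ i, L ∣ M i) → ∀ (n : ℕ) (hn : 1 ≤ n),
        (∀ k k' : ↥(freeT L M),
            ((elimT L M)ᵀ * reDelK n hn M * elimT L M) k k' = ((elimT L M)ᵀ * reDelK n hn M * elimT L M) k' k) ∧
        (∀ w : ↥(freeT L M) → ℝ, gamma2153one d L * ∑ k, w k ^ 2 ≤
            ∑ k, ∑ k', ((elimT L M)ᵀ * reDelK n hn M * elimT L M) k k' * w k * w k') ∧
        (∀ k k' : ↥(freeT L M), |((elimT L M)ᵀ * reDelK n hn M * elimT L M) k k'| ≤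
            KA * Real.exp (-(κA * pdist M (one_le_M M) ((k : B4.Idx (pbox M) d).1 : Fin d → ℤ)
              ((k' : B4.Idx (pbox M) d).1 : Fin d → ℤ)))) := by
  have hd1 : 1 ≤ d := le_trans (by norm_num) hd
  have hL0 : 0 < L := hL
  obtain ⟨c₀, δ₀, hc, hδ, hK⟩ := kernelDecay_reDelK (d := d) hd1
  refine ⟨c₀ * Real.exp (2 * δ₀ * ((L : ℝ) - 1)) * ((L : ℝ) ^ d + 1) * ((L : ℝ) ^ d + 1), δ₀, by positivity, hδ, ?_⟩
  intro M _ hLM n hn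
  have hP : PrintedPer M (one_le_M M) (bondReductionT L M (reDelK n hn M)) (gamma2153one d L) c₀ δ₀
      ((L : ℝ) - 1) ((L : ℝ) ^ d + 1) :=
    bondReductionT_printedPer hL0 hLM (reDelK_isSymm n hn M) (hK M n hn) (lowerOnConstrainedT_reDelK_sharp hd hL n hn hLM)
  refine ⟨fun k k' => ?_, fun w => ?_, fun k k' => ?_⟩
  · exact (B6FromB4.sandwich_isSymm (elimT L M) (reDelK_isSymm n hn M)).apply k' k
  · have h := ineq_2157_reDelK_sharp (M := M) hd hL hLM n hn w
    rw [← sum_mul_mulVec_eq_sum_sum]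
    exact h.2.trans h.1
  · letI : PseudoMetricSpace (Fin d → ℤ) := (zdPer d M (one_le_M M)).pms
    set T := ofPer M (one_le_M M) (bondReductionT L M (reDelK n hn M)) with hT
    have hPT : T.Printed (gamma2153one d L) c₀ δ₀ ((L : ℝ) - 1) ((L : ℝ) ^ d + 1) := hP
    have hMd : ∀ k k' : T.Fk, |(T.Cᵀ * T.Δ * T.C) k k'| ≤ c₀ * Real.exp (2 * δ₀ * ((L : ℝ) - 1)) *
        ((L : ℝ) ^ d + 1) * ((L : ℝ) ^ d + 1) *
        Real.exp (-(δ₀ * dist ((k : (zdPer d M (one_le_M M)).Idx T.Ω d).1 : (zdPer d M (one_le_M M)).S)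
          ((k' : (zdPer d M (one_le_M M)).Idx T.Ω d).1 : (zdPer d M (one_le_M M)).S))) :=
      B6FromB4.sandwich_decay (fun u : (zdPer d M (one_le_M M)).Idx T.Ω d => (u.1 : (zdPer d M (one_le_M M)).S))
        (fun k : T.Fk => ((k : (zdPer d M (one_le_M M)).Idx T.Ω d).1 : (zdPer d M (one_le_M M)).S)) T.Cᵀ T.Δ T.C
        hc.le hδ.le
        (fun i u h => by
          rw [dist_comm]
          exact hPT.range u i (by simpa using h))
        (fun i => by simpa using hPT.col i) hPT.range hPT.col hPT.decay
    exact hMd k k'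

/-! ## §3  The cubic torus `(ℤ/N)^d`: the member PRESENTED on the labelled bent window of `ℤ^{2d+1}` -/

/-- the variables `B′` of the cubic torus are determined by (residue of the base point, direction): the placement
`k ↦ (k₋ mod N, direction of k)` is injective on the box representatives. [folklore] -/
private theorem siteLab_injective (N : ℕ) [NeZero N] (S : Finset (B4.Idx (pbox (fun _ : Fin d => N)) d)) :
    Function.Injective fun k : ↥S =>
      ((fun i : Fin d => ((((k : B4.Idx (pbox (fun _ : Fin d => N)) d).1 : Fin d → ℤ) i : ℤ) : ZMod N)),
        (k : B4.Idx (pbox (fun _ : Fin d => N)) d).2) := by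
  intro k k' h
  simp only [Prod.mk.injEq] at h
  obtain ⟨hs, hl⟩ := h
  have hx : (((k : B4.Idx (pbox (fun _ : Fin d => N)) d).1 : Fin d → ℤ)) =
      (((k' : B4.Idx (pbox (fun _ : Fin d => N)) d).1 : Fin d → ℤ)) := by
    funext i
    have hi := congrFun hs i
    have hk := (mem_pbox.mp (k : B4.Idx (pbox (fun _ : Fin d => N)) d).1.2) i
    have hk' := (mem_pbox.mp (k' : B4.Idx (pbox (fun _ : Fin d => N)) d).1.2) i
    have hmod : (((k : B4.Idx (pbox (fun _ : Fin d => N)) d).1 : Fin d → ℤ) i) % (N : ℤ) =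
        (((k' : B4.Idx (pbox (fun _ : Fin d => N)) d).1 : Fin d → ℤ) i) % (N : ℤ) :=
      (ZMod.intCast_eq_intCast_iff' _ _ _).mp hi
    rwa [Int.emod_eq_of_lt hk.1 hk.2, Int.emod_eq_of_lt hk'.1 hk'.2] at hmod
  exact Subtype.ext (Prod.ext (Subtype.ext hx) hl)

/-- ★★★ **THE GAUGE-FIELD MEMBER KIT ON THE CUBIC TORUS.**  For `d ≥ 2`, `L ≥ 1` there are `K_A ≥ 0`, `κ_A > 0` (from `(d, L)` only; the
coercivity constant is the explicit `γ′₀ = (1/12d²)L^{−d−1}` of (2.157)) such that for EVERY cubic torus `(ℤ/N)^d` with `L ∣ N` and EVERY level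
`n ≥ 1` (`n = L^k`): with `S := C*(Re Δ_k)C` the precision of the Gaussian (2.155) in the remaining bond variables `B′` (`freeT`), there are a window
`Λ ⊂ ℤ^{d+d+1}` and a bijection `e : B′ ≃ Λ` such that the re-indexed precision `A = reindex e e S` is symmetric, `γ′₀`-coercive and decays in the
EUCLIDEAN metric of the window as `K_A e^{−κ_A|x−y|₂}` (the three member rows of `…KernelEq324AnyGamma.eq324_kernel_of_expDecay(_on_unit)` on
`ℤ^{d+d+1}`), the class road's field `μ_K` (`K` = zero-extended `A⁻¹`) PRESENTS `𝒩(0, S⁻¹) = 𝒩(0, (C*Δ_kC)⁻¹)` — the Gaussian of (2.155) in the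
variables `B′` — under `Φ z = z ∘ e`, and the uniform-threshold boxes pull back to `smallFieldSet Λ p` a.e.  Proof: §2 + seat n08-b's bent-window
kit `…ClassTorusWindow.exists_presentation_of_torusDecay` with `site k = k₋ mod N`, `lab k =` the direction of `k` (`m = d` labels), `ρ = ρ_N`
(§1: the torus coordinate distances of the residues are dominated by `ρ_N`).
[cite: Balaban1984PropagatorsII, (2.152)–(2.157) pp.249–250; Balaban1984PropagatorsI, (1.65) p.29; Balaban1985UV3, (22) p.261, (58) p.270 (the
unit torus, trivial background); Balaban1985BackgroundPropagators, Sect. E p.428 (class form; the bent window is seat n08-b's)] -/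
theorem torusGauge_presentation (hd : 2 ≤ d) (hL : 1 ≤ L) :
    ∃ KA κA : ℝ, 0 ≤ KA ∧ 0 < κA ∧
      ∀ (N : ℕ) [NeZero N], L ∣ N → ∀ (n : ℕ) (hn : 1 ≤ n),
        ∃ (Λ : Finset (B1Eq324BenfattoLemma.Site (d + d + 1))) (e : ↥(freeT L (fun _ : Fin d => N)) ≃ ↥Λ),
          (∀ x y : ↥Λ,
              (Matrix.reindex e e ((elimT L (fun _ : Fin d => N))ᵀ * reDelK n hn (fun _ : Fin d => N) * elimT L (fun _ : Fin d => N))) x y =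
                (Matrix.reindex e e ((elimT L (fun _ : Fin d => N))ᵀ * reDelK n hn (fun _ : Fin d => N) * elimT L (fun _ : Fin d => N))) y x) ∧
          (∀ w : ↥Λ → ℝ, gamma2153one d L * ∑ x, w x ^ 2 ≤
              ∑ x, ∑ y, (Matrix.reindex e e ((elimT L (fun _ : Fin d => N))ᵀ * reDelK n hn (fun _ : Fin d => N) *
                elimT L (fun _ : Fin d => N))) x y * w x * w y) ∧
          (∀ x y : ↥Λ,
              |(Matrix.reindex e e ((elimT L (fun _ : Fin d => N))ᵀ * reDelK n hn (fun _ : Fin d => N) * elimT L (fun _ : Fin d => N))) x y| ≤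
                KA * Real.exp (-(κA * Real.sqrt (∑ j,
                  ((((x : B1Eq324BenfattoLemma.Site (d + d + 1)) j : ℝ) - ((y : B1Eq324BenfattoLemma.Site (d + d + 1)) j : ℝ))) ^ 2)))) ∧
          ((gaussianFieldOfKernel fun x y => if h : x ∈ Λ ∧ y ∈ Λ then
                ((Matrix.reindex e e ((elimT L (fun _ : Fin d => N))ᵀ * reDelK n hn (fun _ : Fin d => N) *
                  elimT L (fun _ : Fin d => N)))⁻¹ : Matrix ↥Λ ↥Λ ℝ) ⟨x, h.1⟩ ⟨y, h.2⟩ else 0).map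
              (fun (z : B1Eq324BenfattoLemma.Site (d + d + 1) → ℝ) (b : ↥(freeT L (fun _ : Fin d => N))) =>
                z ((e b : ↥Λ) : B1Eq324BenfattoLemma.Site (d + d + 1))) =
            gaussianFieldOfKernel fun b b' =>
              (((elimT L (fun _ : Fin d => N))ᵀ * reDelK n hn (fun _ : Fin d => N) * elimT L (fun _ : Fin d => N))⁻¹ :
                Matrix ↥(freeT L (fun _ : Fin d => N)) ↥(freeT L (fun _ : Fin d => N)) ℝ) b b') ∧
          (∀ p : ℝ, 0 ≤ p →
            ((fun (z : B1Eq324BenfattoLemma.Site (d + d + 1) → ℝ) (b : ↥(freeT L (fun _ : Fin d => N))) =>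
                z ((e b : ↥Λ) : B1Eq324BenfattoLemma.Site (d + d + 1))) ⁻¹' {ω | ∀ b, |ω b| ≤ p}) =ᵐ[gaussianFieldOfKernel fun x y =>
                  if h : x ∈ Λ ∧ y ∈ Λ then
                    ((Matrix.reindex e e ((elimT L (fun _ : Fin d => N))ᵀ * reDelK n hn (fun _ : Fin d => N) *
                      elimT L (fun _ : Fin d => N)))⁻¹ : Matrix ↥Λ ↥Λ ℝ) ⟨x, h.1⟩ ⟨y, h.2⟩ else 0] smallFieldSet Λ p) := by
  have hd1 : 1 ≤ d := le_trans (by norm_num) hd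
  obtain ⟨KA, κA, hKA, hκA, hmem⟩ := torusGauge_classMember (d := d) (L := L) hd hL
  have hγ := gamma2153one_pos hd1 hL
  refine ⟨KA * Real.exp (κA * (d : ℕ)), κA / Real.sqrt (d + d + 1), by positivity, by positivity, ?_⟩
  intro N _ hLN n hn
  obtain ⟨hSs, hSco, hSdec⟩ := hmem (fun _ : Fin d => N) (fun _ => hLN) n hn
  obtain ⟨Λ, e, hsymm, hcoer, hdec', hmap, hbox⟩ :=
    exists_presentation_of_torusDecay d N d (by omega)
      (fun k : ↥(freeT L (fun _ : Fin d => N)) =>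
        (fun i : Fin d => ((((k : B4.Idx (pbox (fun _ : Fin d => N)) d).1 : Fin d → ℤ) i : ℤ) : ZMod N)))
      (fun k : ↥(freeT L (fun _ : Fin d => N)) => (k : B4.Idx (pbox (fun _ : Fin d => N)) d).2)
      (siteLab_injective N (freeT L (fun _ : Fin d => N))) hSs hγ hSco hKA hκA.le hSdec
      (fun k k' i => abs_valMinAbs_le_pdist N _ _ i)
  exact ⟨Λ, e, hsymm, hcoer, hdec', hmap, hbox⟩

/-! ## §4  B1 (3.24) for the Gaussian field of `C*Δ_kC` on the cubic torus, zero background, every level and coupling -/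

/-- ★★★★ **[Balaban1982Higgs1] (3.24) FOR THE GAUSS­IAN FIELD OF THE GAUGE-FIELD FLUCTUATION PRECISION `C*Δ_kC` OF [Balaban1984PropagatorsII]
(2.155) ON THE UNIT TORUS, ZERO BACKGROUND, AT EVERY COUPLING `η ∈ (0,1]` — UNCONDITIONAL.**  For `d ≥ 2`, `L ≥ 1`, every order `t`, degree `D`, tree
rate `ϰ > 0` and rate letters `p₀ > 2/3`, `σ > 0`, `c ≥ 0`, `0 < κ < σ(t+1)` there is a threshold window `b₁` (from `(d, L)` and the letters only) such
that for every `b₀ > b₁` there is `C ≥ 0` with: for EVERY cubic torus `(ℤ/N)^d` with `L ∣ N` whose set of remaining bond variables `B′` is non-empty and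
EVERY level `n ≥ 1`, there are a window `Λ ⊂ ℤ^{d+d+1}` and a bijection `e : B′ ≃ Λ` such that the class road's field `μ_K` (`K` = zero-extension of
`(reindex e e (C*Δ_kC))⁻¹`) PRESENTS the Gaussian `𝒩(0, (C*Δ_kC)⁻¹)` of (2.155) in the variables `B′` (`(μ_K).map (z ↦ z ∘ e) = 𝒩(0, (C*Δ_kC)⁻¹)`),
its uniform-threshold boxes pull back to `smallFieldSet Λ p` a.e., and for all `η ∈ (0,1]` and every `(s, J ⊆ I, J ⊆ Λ, 𝔄)` with `I ≠ ∅`,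
`sup|𝔄| ≤ c·η^σ`: `0 < ∫Π_{Δ∈I}χ̂_{p(η)} e^{H_J} dμ_K` and `|log ∫Π_{Δ∈I}χ̂_{p(η)} e^{H_J} dμ_K − Σ_{k≤t}𝓔^T(H_J;k)/k!| ≤ C·η^κ·|I|`.
Proof: §3 (member kit, constants from `(d, L)`) ∘ seat n08-b's `…KernelEq324AnyGammaUnitRange.eq324_kernel_of_expDecay_on_unit` on `ℤ^{d+d+1}`
with `(γ_A, K_A, κ_A) = (γ′₀, K_A e^{κ_A d}, κ_A/√(2d+1))`.  The interaction is the road's generic (4.5)-Hamiltonian on the window (class II letters NOT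
identified); the window `b₁ < b₀` is displayed.
[cite: Balaban1982Higgs1, (3.24) p.616; Balaban1984PropagatorsII, (2.152)–(2.157) pp.249–250; Balaban1984PropagatorsI, (1.65) p.29; Balaban1985UV3,
(7) p.257, (22) p.261, (58) p.270 (unit torus, trivial background); BenfattoEtAl1978, Lemma (4.5)–(4.7) p.152, Appendix C (C.1)–(C.2) p.164;
Balaban1985BackgroundPropagators, (1.16)–(1.18) p.180, Sect. E p.428 (class form; ours)] -/
theorem eq324_torusGaugeFluctuation_on_unit (hd : 2 ≤ d) (hL : 1 ≤ L) (t D : ℕ) {ϰ : ℝ} (hϰ : 0 < ϰ) {p₀ σ c κ : ℝ}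
    (hp₀ : 2 / 3 < p₀) (hσ : 0 < σ) (hc : 0 ≤ c) (hκ : 0 < κ) (hκσ : κ < σ * (t + 1)) :
    ∃ b₁ : ℝ, ∀ b₀ : ℝ, b₁ < b₀ → ∃ C : ℝ, 0 ≤ C ∧
      ∀ (N : ℕ) [NeZero N], L ∣ N → (freeT L (fun _ : Fin d => N)).Nonempty → ∀ (n : ℕ) (hn : 1 ≤ n),
        ∃ (Λ : Finset (B1Eq324BenfattoLemma.Site (d + d + 1))) (e : ↥(freeT L (fun _ : Fin d => N)) ≃ ↥Λ),
          ((gaussianFieldOfKernel (fun x y => if h : x ∈ Λ ∧ y ∈ Λ then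
                  ((Matrix.reindex e e ((elimT L (fun _ : Fin d => N))ᵀ * reDelK n hn (fun _ : Fin d => N) * elimT L (fun _ : Fin d => N)))⁻¹ : Matrix ↥Λ ↥Λ ℝ) ⟨x, h.1⟩ ⟨y, h.2⟩ else 0)).map
              (fun (z : B1Eq324BenfattoLemma.Site (d + d + 1) → ℝ) (b : ↥(freeT L (fun _ : Fin d => N))) =>
                z ((e b : ↥Λ) : B1Eq324BenfattoLemma.Site (d + d + 1))) =
            gaussianFieldOfKernel fun b b' =>
              ((((elimT L (fun _ : Fin d => N))ᵀ * reDelK n hn (fun _ : Fin d => N) * elimT L (fun _ : Fin d => N)))⁻¹ : Matrix ↥(freeT L (fun _ : Fin d => N)) ↥(freeT L (fun _ : Fin d => N)) ℝ) b b') ∧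
          (∀ p : ℝ, 0 ≤ p →
            ((fun (z : B1Eq324BenfattoLemma.Site (d + d + 1) → ℝ) (b : ↥(freeT L (fun _ : Fin d => N))) =>
                z ((e b : ↥Λ) : B1Eq324BenfattoLemma.Site (d + d + 1))) ⁻¹' {ω | ∀ b, |ω b| ≤ p}) =ᵐ[gaussianFieldOfKernel (fun x y => if h : x ∈ Λ ∧ y ∈ Λ then
                  ((Matrix.reindex e e ((elimT L (fun _ : Fin d => N))ᵀ * reDelK n hn (fun _ : Fin d => N) * elimT L (fun _ : Fin d => N)))⁻¹ : Matrix ↥Λ ↥Λ ℝ) ⟨x, h.1⟩ ⟨y, h.2⟩ else 0)]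
              smallFieldSet Λ p) ∧
          ∀ η : ℝ, 0 < η → η ≤ 1 →
            ∀ (s : ℕ) (I J : Finset (B1Eq324BenfattoLemma.Site (d + d + 1))) (a : Coef (d + d + 1)), I.Nonempty → J ⊆ I → J ⊆ Λ →
              coefSup s D a J ≤ c * η ^ σ →
              0 < ∫ z, cutoffBoltzmann (hamiltonian s D ϰ a J) I (B10.pFun b₀ p₀ η) z ∂(gaussianFieldOfKernel (fun x y => if h : x ∈ Λ ∧ y ∈ Λ then
                  ((Matrix.reindex e e ((elimT L (fun _ : Fin d => N))ᵀ * reDelK n hn (fun _ : Fin d => N) * elimT L (fun _ : Fin d => N)))⁻¹ : Matrix ↥Λ ↥Λ ℝ) ⟨x, h.1⟩ ⟨y, h.2⟩ else 0)) ∧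
                |Real.log (∫ z, cutoffBoltzmann (hamiltonian s D ϰ a J) I (B10.pFun b₀ p₀ η) z ∂(gaussianFieldOfKernel (fun x y => if h : x ∈ Λ ∧ y ∈ Λ then
                  ((Matrix.reindex e e ((elimT L (fun _ : Fin d => N))ᵀ * reDelK n hn (fun _ : Fin d => N) * elimT L (fun _ : Fin d => N)))⁻¹ : Matrix ↥Λ ↥Λ ℝ) ⟨x, h.1⟩ ⟨y, h.2⟩ else 0))) -
                    cumulantSum (gaussianFieldOfKernel (fun x y => if h : x ∈ Λ ∧ y ∈ Λ then
                  ((Matrix.reindex e e ((elimT L (fun _ : Fin d => N))ᵀ * reDelK n hn (fun _ : Fin d => N) * elimT L (fun _ : Fin d => N)))⁻¹ : Matrix ↥Λ ↥Λ ℝ) ⟨x, h.1⟩ ⟨y, h.2⟩ else 0)) (hamiltonian s D ϰ a J) t| ≤ C * η ^ κ * I.card := by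
  have hd' : 0 < d + d + 1 := by omega
  obtain ⟨KA, κA, hKA, hκA, hkit⟩ := torusGauge_presentation (d := d) (L := L) hd hL
  have hγ := gamma2153one_pos (le_trans (by norm_num) hd) hL
  obtain ⟨b₁, hb₁⟩ := eq324_kernel_of_expDecay_on_unit (d := d + d + 1) hd' hγ hKA hκA t D hϰ hp₀ hσ hc hκ hκσ
  refine ⟨b₁, fun b₀ hb₀ => ?_⟩
  obtain ⟨C, hC, hE⟩ := hb₁ b₀ hb₀
  refine ⟨C, hC, fun N _ hLN hne n hn => ?_⟩
  obtain ⟨Λ, e, hsymm, hcoer, hdec', hmap, hbox⟩ := hkit N hLN n hn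
  refine ⟨Λ, e, hmap, hbox, fun η hη hη1 s I J a hI hJI hJΛ hA => ?_⟩
  obtain ⟨k, hk⟩ := hne
  have hΛ : Λ.Nonempty := ⟨_, (e ⟨k, hk⟩).2⟩
  exact hE η hη hη1 (fun x y => rfl) hΛ hsymm hcoer hdec' s I J a hI hJI hJΛ hA

/-- ★★★ **(3.24) FOR THE GAUGE-FIELD FLUCTUATION PRECISION ON THE TORUS — THE `η₀`-WINDOW EDITION** (fixed `b₀ > 0`; `∃ η₀ ∈ (0,1], C ≥ 0, ∀ η ≤ η₀`):
the same presentation and the same (3.24) pair, over seat n08-b's `…KernelEq324AnyGamma.eq324_kernel_of_expDecay`.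
[cite: Balaban1982Higgs1, (3.24) p.616; Balaban1984PropagatorsII, (2.152)–(2.157) pp.249–250; Balaban1984PropagatorsI, (1.65) p.29;
BenfattoEtAl1978, Lemma (4.5)–(4.7) p.152; Balaban1985BackgroundPropagators, Sect. E p.428 (class form; ours)] -/
theorem eq324_torusGaugeFluctuation (hd : 2 ≤ d) (hL : 1 ≤ L) (t D : ℕ) {ϰ : ℝ} (hϰ : 0 < ϰ) {b₀ p₀ σ c κ : ℝ} (hb₀ : 0 < b₀)
    (hp₀ : 2 / 3 < p₀) (hσ : 0 < σ) (hc : 0 ≤ c) (hκ : 0 < κ) (hκσ : κ < σ * (t + 1)) :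
    ∃ η₀ C : ℝ, 0 < η₀ ∧ η₀ ≤ 1 ∧ 0 ≤ C ∧
      ∀ (N : ℕ) [NeZero N], L ∣ N → (freeT L (fun _ : Fin d => N)).Nonempty → ∀ (n : ℕ) (hn : 1 ≤ n),
        ∃ (Λ : Finset (B1Eq324BenfattoLemma.Site (d + d + 1))) (e : ↥(freeT L (fun _ : Fin d => N)) ≃ ↥Λ),
          ((gaussianFieldOfKernel (fun x y => if h : x ∈ Λ ∧ y ∈ Λ then
                  ((Matrix.reindex e e ((elimT L (fun _ : Fin d => N))ᵀ * reDelK n hn (fun _ : Fin d => N) * elimT L (fun _ : Fin d => N)))⁻¹ : Matrix ↥Λ ↥Λ ℝ) ⟨x, h.1⟩ ⟨y, h.2⟩ else 0)).map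
              (fun (z : B1Eq324BenfattoLemma.Site (d + d + 1) → ℝ) (b : ↥(freeT L (fun _ : Fin d => N))) =>
                z ((e b : ↥Λ) : B1Eq324BenfattoLemma.Site (d + d + 1))) =
            gaussianFieldOfKernel fun b b' =>
              ((((elimT L (fun _ : Fin d => N))ᵀ * reDelK n hn (fun _ : Fin d => N) * elimT L (fun _ : Fin d => N)))⁻¹ : Matrix ↥(freeT L (fun _ : Fin d => N)) ↥(freeT L (fun _ : Fin d => N)) ℝ) b b') ∧
          (∀ p : ℝ, 0 ≤ p →
            ((fun (z : B1Eq324BenfattoLemma.Site (d + d + 1) → ℝ) (b : ↥(freeT L (fun _ : Fin d => N))) =>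
                z ((e b : ↥Λ) : B1Eq324BenfattoLemma.Site (d + d + 1))) ⁻¹' {ω | ∀ b, |ω b| ≤ p}) =ᵐ[gaussianFieldOfKernel (fun x y => if h : x ∈ Λ ∧ y ∈ Λ then
                  ((Matrix.reindex e e ((elimT L (fun _ : Fin d => N))ᵀ * reDelK n hn (fun _ : Fin d => N) * elimT L (fun _ : Fin d => N)))⁻¹ : Matrix ↥Λ ↥Λ ℝ) ⟨x, h.1⟩ ⟨y, h.2⟩ else 0)]
              smallFieldSet Λ p) ∧
          ∀ η : ℝ, 0 < η → η ≤ η₀ →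
            ∀ (s : ℕ) (I J : Finset (B1Eq324BenfattoLemma.Site (d + d + 1))) (a : Coef (d + d + 1)), I.Nonempty → J ⊆ I → J ⊆ Λ →
              coefSup s D a J ≤ c * η ^ σ →
              0 < ∫ z, cutoffBoltzmann (hamiltonian s D ϰ a J) I (B10.pFun b₀ p₀ η) z ∂(gaussianFieldOfKernel (fun x y => if h : x ∈ Λ ∧ y ∈ Λ then
                  ((Matrix.reindex e e ((elimT L (fun _ : Fin d => N))ᵀ * reDelK n hn (fun _ : Fin d => N) * elimT L (fun _ : Fin d => N)))⁻¹ : Matrix ↥Λ ↥Λ ℝ) ⟨x, h.1⟩ ⟨y, h.2⟩ else 0)) ∧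
                |Real.log (∫ z, cutoffBoltzmann (hamiltonian s D ϰ a J) I (B10.pFun b₀ p₀ η) z ∂(gaussianFieldOfKernel (fun x y => if h : x ∈ Λ ∧ y ∈ Λ then
                  ((Matrix.reindex e e ((elimT L (fun _ : Fin d => N))ᵀ * reDelK n hn (fun _ : Fin d => N) * elimT L (fun _ : Fin d => N)))⁻¹ : Matrix ↥Λ ↥Λ ℝ) ⟨x, h.1⟩ ⟨y, h.2⟩ else 0))) -
                    cumulantSum (gaussianFieldOfKernel (fun x y => if h : x ∈ Λ ∧ y ∈ Λ then
                  ((Matrix.reindex e e ((elimT L (fun _ : Fin d => N))ᵀ * reDelK n hn (fun _ : Fin d => N) * elimT L (fun _ : Fin d => N)))⁻¹ : Matrix ↥Λ ↥Λ ℝ) ⟨x, h.1⟩ ⟨y, h.2⟩ else 0)) (hamiltonian s D ϰ a J) t| ≤ C * η ^ κ * I.card := by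
  have hd' : 0 < d + d + 1 := by omega
  obtain ⟨KA, κA, hKA, hκA, hkit⟩ := torusGauge_presentation (d := d) (L := L) hd hL
  have hγ := gamma2153one_pos (le_trans (by norm_num) hd) hL
  obtain ⟨η₀, C, hη₀, hη₀1, hC, hE⟩ := eq324_kernel_of_expDecay (d := d + d + 1) hd' hγ hKA hκA t D hϰ hb₀ hp₀ hσ hc hκ hκσ
  refine ⟨η₀, C, hη₀, hη₀1, hC, fun N _ hLN hne n hn => ?_⟩
  obtain ⟨Λ, e, hsymm, hcoer, hdec', hmap, hbox⟩ := hkit N hLN n hn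
  refine ⟨Λ, e, hmap, hbox, fun η hη hηle s I J a hI hJI hJΛ hA => ?_⟩
  obtain ⟨k, hk⟩ := hne
  have hΛ : Λ.Nonempty := ⟨_, (e ⟨k, hk⟩).2⟩
  exact hE η hη hηle (fun x y => rfl) hΛ hsymm hcoer hdec' s I J a hI hJI hJΛ hA

/-! ## §5  Every sub-family of the remaining variables — in particular the `Λ`-bonds of a region `Λ = B(Λ′₀) ⊂ T^{(k)}` -/

/-- ★★ **SUB-FAMILIES: `C_S*Δ_kC_S` IS A CLASS MEMBER WITH THE SAME CONSTANTS.**  For `d ≥ 2`, `L ≥ 1`, with the `(K_A, κ_A)` of §2's proof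
(from `(d, L)` only): for EVERY torus `M` (`L ∣ M_i`), EVERY level `n ≥ 1` and EVERY sub-family `S ⊆ B′ = freeT L M` of the remaining bond variables
— in particular `S = lamFree L M Λ′₀`, the `Λ`-bonds of a region `Λ = B(Λ′₀)` of the torus, whose reduction is `C^{(k)}_Λ` of (2.156)
(`B6Cov2156TorusSubset.bondReductionLam`) — the precision `S_S := C_Sᵀ·(Re Δ_k)·C_S` of the Gaussian (2.152)/(2.155) «on a subset Λ ⊂ T^{(k)}» in
the variables `S` (`C_S = elimTS L M S hS`, the columns of `C` at `S`) is symmetric, `γ′₀`-coercive (`γ′₀ = (1/12d²)L^{−d−1}`) and has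
`|(S_S)_{kk′}| ≤ K_A e^{−κ_A ρ_M(k₋,k′₋)}` — over `B6Cov2156TorusSubset.subFamilyT_printedPer` (same range and `ℓ¹` constants as the whole family) and
`B6FromB4.sandwich_isSymm` / `sandwich_lowerBound` / `sandwich_decay`.
[cite: Balaban1984PropagatorsII, (2.152) p.249 «on the whole lattice T^{(k)}, or on a subset Λ ⊂ T^{(k)}», (2.154)–(2.157) pp.249–250, Lemma 2.4
p.245; Balaban1984PropagatorsI, (1.65) p.29; Balaban1985BackgroundPropagators, Sect. E p.428 (class form; ours)] -/
theorem torusGaugeSub_classMember (hd : 2 ≤ d) (hL : 1 ≤ L) :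
    ∃ KA κA : ℝ, 0 ≤ KA ∧ 0 < κA ∧
      ∀ (M : Fin d → ℕ) [∀ μ, NeZero (M μ)], (∀ i, L ∣ M i) → ∀ (n : ℕ) (hn : 1 ≤ n)
        (S : Finset (B4.Idx (pbox M) d)) (hS : S ⊆ freeT L M),
        (∀ k k' : ↥S,
            ((elimTS L M S hS)ᵀ * reDelK n hn M * elimTS L M S hS) k k' = ((elimTS L M S hS)ᵀ * reDelK n hn M * elimTS L M S hS) k' k) ∧
        (∀ w : ↥S → ℝ, gamma2153one d L * ∑ k, w k ^ 2 ≤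
            ∑ k, ∑ k', ((elimTS L M S hS)ᵀ * reDelK n hn M * elimTS L M S hS) k k' * w k * w k') ∧
        (∀ k k' : ↥S, |((elimTS L M S hS)ᵀ * reDelK n hn M * elimTS L M S hS) k k'| ≤
            KA * Real.exp (-(κA * pdist M (one_le_M M) ((k : B4.Idx (pbox M) d).1 : Fin d → ℤ)
              ((k' : B4.Idx (pbox M) d).1 : Fin d → ℤ)))) := by
  have hd1 : 1 ≤ d := le_trans (by norm_num) hd
  have hL0 : 0 < L := hL
  obtain ⟨c₀, δ₀, hc, hδ, hK⟩ := kernelDecay_reDelK (d := d) hd1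
  refine ⟨c₀ * Real.exp (2 * δ₀ * ((L : ℝ) - 1)) * ((L : ℝ) ^ d + 1) * ((L : ℝ) ^ d + 1), δ₀, by positivity, hδ, ?_⟩
  intro M _ hLM n hn S hS
  have hγ := gamma2153one_pos hd1 hL
  have hP : PrintedPer M (one_le_M M) (subFamilyT L M S hS (reDelK n hn M)) (gamma2153one d L) c₀ δ₀
      ((L : ℝ) - 1) ((L : ℝ) ^ d + 1) :=
    subFamilyT_printedPer hS hL0 hLM (reDelK_isSymm n hn M) (hK M n hn) (lowerOnConstrainedT_reDelK_sharp hd hL n hn hLM)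
  letI : PseudoMetricSpace (Fin d → ℤ) := (zdPer d M (one_le_M M)).pms
  set T := ofPer M (one_le_M M) (subFamilyT L M S hS (reDelK n hn M)) with hT
  have hPT : T.Printed (gamma2153one d L) c₀ δ₀ ((L : ℝ) - 1) ((L : ℝ) ^ d + 1) := hP
  refine ⟨fun k k' => ?_, fun w => ?_, fun k k' => ?_⟩
  · exact (B6FromB4.sandwich_isSymm (elimTS L M S hS) (reDelK_isSymm n hn M)).apply k' k
  · rw [← sum_mul_mulVec_eq_sum_sum]
    exact B6FromB4.sandwich_lowerBound T.C T.Δ hγ.le hPT.lower hPT.iso w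
  · have hMd : ∀ k k' : T.Fk, |(T.Cᵀ * T.Δ * T.C) k k'| ≤ c₀ * Real.exp (2 * δ₀ * ((L : ℝ) - 1)) *
        ((L : ℝ) ^ d + 1) * ((L : ℝ) ^ d + 1) *
        Real.exp (-(δ₀ * dist ((k : (zdPer d M (one_le_M M)).Idx T.Ω d).1 : (zdPer d M (one_le_M M)).S)
          ((k' : (zdPer d M (one_le_M M)).Idx T.Ω d).1 : (zdPer d M (one_le_M M)).S))) :=
      B6FromB4.sandwich_decay (fun u : (zdPer d M (one_le_M M)).Idx T.Ω d => (u.1 : (zdPer d M (one_le_M M)).S))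
        (fun k : T.Fk => ((k : (zdPer d M (one_le_M M)).Idx T.Ω d).1 : (zdPer d M (one_le_M M)).S)) T.Cᵀ T.Δ T.C
        hc.le hδ.le
        (fun i u h => by
          rw [dist_comm]
          exact hPT.range u i (by simpa using h))
        (fun i => by simpa using hPT.col i) hPT.range hPT.col hPT.decay
    exact hMd k k'

/-- ★★★★ **(3.24) FOR THE GAUSSIAN OF `C_S*Δ_kC_S` — EVERY SUB-FAMILY `S` OF THE REMAINING VARIABLES OF A CUBIC TORUS, AT EVERY COUPLING** (so, with
`S = lamFree L M Λ′₀`, for the fluctuation integral (2.152) «on a subset Λ ⊂ T^{(k)}», `Λ = B(Λ′₀)`): `∃ b₁ ∀ b₀ > b₁ ∃ C ≥ 0 ∀ N` (`L ∣ N`) `∀ n ≥ 1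
∀ S ⊆ B′` (`S ≠ ∅`) `∃ Λ ⊂ ℤ^{d+d+1}, e : S ≃ Λ`: `(μ_K).map (z ↦ z ∘ e) = 𝒩(0, (C_S*Δ_kC_S)⁻¹)` (`K` = zero-extended `(reindex e e (C_S*Δ_kC_S))⁻¹`),
the box pull-back a.e., and for all `η ∈ (0,1]` and every `(s, J ⊆ I, J ⊆ Λ, 𝔄)` with `I ≠ ∅`, `sup|𝔄| ≤ c·η^σ`: the (3.24) pair — §5's rows ∘ seat
n08-b's `exists_presentation_of_torusDecay` ∘ `eq324_kernel_of_expDecay_on_unit` on `ℤ^{d+d+1}`, constants from `(d, L)` and the letters only.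
[cite: Balaban1982Higgs1, (3.24) p.616; Balaban1984PropagatorsII, (2.152)–(2.157) pp.249–250, Lemma 2.4 p.245; Balaban1984PropagatorsI, (1.65)
p.29; Balaban1985UV3, (7) p.257, (22) p.261, (58) p.270; BenfattoEtAl1978, Lemma (4.5)–(4.7) p.152; Balaban1985BackgroundPropagators, Sect. E p.428
(class form; ours)] -/
theorem eq324_torusGaugeFluctuationSub_on_unit (hd : 2 ≤ d) (hL : 1 ≤ L) (t D : ℕ) {ϰ : ℝ} (hϰ : 0 < ϰ) {p₀ σ c κ : ℝ}
    (hp₀ : 2 / 3 < p₀) (hσ : 0 < σ) (hc : 0 ≤ c) (hκ : 0 < κ) (hκσ : κ < σ * (t + 1)) :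
    ∃ b₁ : ℝ, ∀ b₀ : ℝ, b₁ < b₀ → ∃ C : ℝ, 0 ≤ C ∧
      ∀ (N : ℕ) [NeZero N], L ∣ N → ∀ (n : ℕ) (hn : 1 ≤ n)
        (S : Finset (B4.Idx (pbox (fun _ : Fin d => N)) d)) (hS : S ⊆ freeT L (fun _ : Fin d => N)), S.Nonempty →
        ∃ (Λ : Finset (B1Eq324BenfattoLemma.Site (d + d + 1))) (e : ↥S ≃ ↥Λ),
          ((gaussianFieldOfKernel (fun x y => if h : x ∈ Λ ∧ y ∈ Λ then
                  ((Matrix.reindex e e ((elimTS L (fun _ : Fin d => N) S hS)ᵀ * reDelK n hn (fun _ : Fin d => N) * elimTS L (fun _ : Fin d => N) S hS))⁻¹ : Matrix ↥Λ ↥Λ ℝ) ⟨x, h.1⟩ ⟨y, h.2⟩ else 0)).map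
              (fun (z : B1Eq324BenfattoLemma.Site (d + d + 1) → ℝ) (b : ↥S) =>
                z ((e b : ↥Λ) : B1Eq324BenfattoLemma.Site (d + d + 1))) =
            gaussianFieldOfKernel fun b b' => ((((elimTS L (fun _ : Fin d => N) S hS)ᵀ * reDelK n hn (fun _ : Fin d => N) * elimTS L (fun _ : Fin d => N) S hS))⁻¹ : Matrix ↥S ↥S ℝ) b b') ∧
          (∀ p : ℝ, 0 ≤ p →
            ((fun (z : B1Eq324BenfattoLemma.Site (d + d + 1) → ℝ) (b : ↥S) =>
                z ((e b : ↥Λ) : B1Eq324BenfattoLemma.Site (d + d + 1))) ⁻¹' {ω | ∀ b, |ω b| ≤ p}) =ᵐ[gaussianFieldOfKernel (fun x y => if h : x ∈ Λ ∧ y ∈ Λ then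
                  ((Matrix.reindex e e ((elimTS L (fun _ : Fin d => N) S hS)ᵀ * reDelK n hn (fun _ : Fin d => N) * elimTS L (fun _ : Fin d => N) S hS))⁻¹ : Matrix ↥Λ ↥Λ ℝ) ⟨x, h.1⟩ ⟨y, h.2⟩ else 0)]
              smallFieldSet Λ p) ∧
          ∀ η : ℝ, 0 < η → η ≤ 1 →
            ∀ (s : ℕ) (I J : Finset (B1Eq324BenfattoLemma.Site (d + d + 1))) (a : Coef (d + d + 1)), I.Nonempty → J ⊆ I → J ⊆ Λ →
              coefSup s D a J ≤ c * η ^ σ →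
              0 < ∫ z, cutoffBoltzmann (hamiltonian s D ϰ a J) I (B10.pFun b₀ p₀ η) z ∂(gaussianFieldOfKernel (fun x y => if h : x ∈ Λ ∧ y ∈ Λ then
                  ((Matrix.reindex e e ((elimTS L (fun _ : Fin d => N) S hS)ᵀ * reDelK n hn (fun _ : Fin d => N) * elimTS L (fun _ : Fin d => N) S hS))⁻¹ : Matrix ↥Λ ↥Λ ℝ) ⟨x, h.1⟩ ⟨y, h.2⟩ else 0)) ∧
                |Real.log (∫ z, cutoffBoltzmann (hamiltonian s D ϰ a J) I (B10.pFun b₀ p₀ η) z ∂(gaussianFieldOfKernel (fun x y => if h : x ∈ Λ ∧ y ∈ Λ then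
                  ((Matrix.reindex e e ((elimTS L (fun _ : Fin d => N) S hS)ᵀ * reDelK n hn (fun _ : Fin d => N) * elimTS L (fun _ : Fin d => N) S hS))⁻¹ : Matrix ↥Λ ↥Λ ℝ) ⟨x, h.1⟩ ⟨y, h.2⟩ else 0))) -
                    cumulantSum (gaussianFieldOfKernel (fun x y => if h : x ∈ Λ ∧ y ∈ Λ then
                  ((Matrix.reindex e e ((elimTS L (fun _ : Fin d => N) S hS)ᵀ * reDelK n hn (fun _ : Fin d => N) * elimTS L (fun _ : Fin d => N) S hS))⁻¹ : Matrix ↥Λ ↥Λ ℝ) ⟨x, h.1⟩ ⟨y, h.2⟩ else 0)) (hamiltonian s D ϰ a J) t| ≤ C * η ^ κ * I.card := by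
  have hd' : 0 < d + d + 1 := by omega
  have hd1 : 1 ≤ d := le_trans (by norm_num) hd
  obtain ⟨KA, κA, hKA, hκA, hmem⟩ := torusGaugeSub_classMember (d := d) (L := L) hd hL
  have hγ := gamma2153one_pos hd1 hL
  have hKA' : 0 ≤ KA * Real.exp (κA * (d : ℕ)) := by positivity
  have hκA' : 0 < κA / Real.sqrt (d + d + 1) := by positivity
  obtain ⟨b₁, hb₁⟩ := eq324_kernel_of_expDecay_on_unit (d := d + d + 1) hd' hγ hKA' hκA' t D hϰ hp₀ hσ hc hκ hκσ
  refine ⟨b₁, fun b₀ hb₀ => ?_⟩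
  obtain ⟨C, hC, hE⟩ := hb₁ b₀ hb₀
  refine ⟨C, hC, fun N _ hLN n hn S hS hne => ?_⟩
  obtain ⟨hSs, hSco, hSdec⟩ := hmem (fun _ : Fin d => N) (fun _ => hLN) n hn S hS
  obtain ⟨Λ, e, hsymm, hcoer, hdec', hmap, hbox⟩ :=
    exists_presentation_of_torusDecay d N d (by omega)
      (fun k : ↥S => (fun i : Fin d => ((((k : B4.Idx (pbox (fun _ : Fin d => N)) d).1 : Fin d → ℤ) i : ℤ) : ZMod N)))
      (fun k : ↥S => (k : B4.Idx (pbox (fun _ : Fin d => N)) d).2)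
      (siteLab_injective N S) hSs hγ hSco hKA hκA.le hSdec
      (fun k k' i => abs_valMinAbs_le_pdist N _ _ i)
  refine ⟨Λ, e, hmap, hbox, fun η hη hη1 s I J a hI hJI hJΛ hA => ?_⟩
  obtain ⟨k, hk⟩ := hne
  have hΛ : Λ.Nonempty := ⟨_, (e ⟨k, hk⟩).2⟩
  exact hE η hη hη1 (fun x y => rfl) hΛ hsymm hcoer hdec' s I J a hI hJI hJΛ hA

/-! ## Non-vacuity at the physical dimension -/

/-- non-vacuity at `d = 3` (window `ℤ^7`), `L = 2`, the d = 3 lane's letters `t = 6`, `D = 4`, `ϰ = 1`, `p₀ = 1`, `σ = ½`, `c = 1`, `κ = 13/4`: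
the member kit and the threshold window exist; (3.24) is a genuine statement about the Gaussian of `C*Δ_kC` on every cubic torus `(ℤ/N)^3`,
`2 ∣ N`, at every level and every coupling `η ∈ (0,1]`. -/
example : ∃ KA κA : ℝ, 0 ≤ KA ∧ 0 < κA ∧
    ∀ (M : Fin 3 → ℕ) [∀ μ, NeZero (M μ)], (∀ i, 2 ∣ M i) → ∀ (n : ℕ) (hn : 1 ≤ n),
      (∀ k k' : ↥(freeT 2 M),
          ((elimT 2 M)ᵀ * reDelK n hn M * elimT 2 M) k k' = ((elimT 2 M)ᵀ * reDelK n hn M * elimT 2 M) k' k) ∧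
      (∀ w : ↥(freeT 2 M) → ℝ, gamma2153one 3 2 * ∑ k, w k ^ 2 ≤
          ∑ k, ∑ k', ((elimT 2 M)ᵀ * reDelK n hn M * elimT 2 M) k k' * w k * w k') ∧
      (∀ k k' : ↥(freeT 2 M), |((elimT 2 M)ᵀ * reDelK n hn M * elimT 2 M) k k'| ≤
          KA * Real.exp (-(κA * pdist M (one_le_M M) ((k : B4.Idx (pbox M) 3).1 : Fin 3 → ℤ)
            ((k' : B4.Idx (pbox M) 3).1 : Fin 3 → ℤ)))) :=
  torusGauge_classMember (d := 3) (L := 2) (by norm_num) (by norm_num)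

/-- non-vacuity at `d = 4` (the dimension of the programme; window `ℤ^9`), `L = 2`: the member rows for every sub-family of the remaining variables
of every 4-dimensional torus with even periods, every level. -/
example : ∃ KA κA : ℝ, 0 ≤ KA ∧ 0 < κA ∧
    ∀ (M : Fin 4 → ℕ) [∀ μ, NeZero (M μ)], (∀ i, 2 ∣ M i) → ∀ (n : ℕ) (hn : 1 ≤ n)
      (S : Finset (B4.Idx (pbox M) 4)) (hS : S ⊆ freeT 2 M),
      (∀ k k' : ↥S,
          ((elimTS 2 M S hS)ᵀ * reDelK n hn M * elimTS 2 M S hS) k k' = ((elimTS 2 M S hS)ᵀ * reDelK n hn M * elimTS 2 M S hS) k' k) ∧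
      (∀ w : ↥S → ℝ, gamma2153one 4 2 * ∑ k, w k ^ 2 ≤
          ∑ k, ∑ k', ((elimTS 2 M S hS)ᵀ * reDelK n hn M * elimTS 2 M S hS) k k' * w k * w k') ∧
      (∀ k k' : ↥S, |((elimTS 2 M S hS)ᵀ * reDelK n hn M * elimTS 2 M S hS) k k'| ≤
          KA * Real.exp (-(κA * pdist M (one_le_M M) ((k : B4.Idx (pbox M) 4).1 : Fin 4 → ℤ)
            ((k' : B4.Idx (pbox M) 4).1 : Fin 4 → ℤ)))) :=
  torusGaugeSub_classMember (d := 4) (L := 2) (by norm_num) (by norm_num)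

example : ∃ b₁ : ℝ, ∀ b₀ : ℝ, b₁ < b₀ → ∃ C : ℝ, 0 ≤ C ∧
    ∀ (N : ℕ) [NeZero N], 2 ∣ N → (freeT 2 (fun _ : Fin 3 => N)).Nonempty → ∀ (n : ℕ) (hn : 1 ≤ n),
      ∃ (Λ : Finset (B1Eq324BenfattoLemma.Site (3 + 3 + 1))) (e : ↥(freeT 2 (fun _ : Fin 3 => N)) ≃ ↥Λ),
        ((gaussianFieldOfKernel (fun x y => if h : x ∈ Λ ∧ y ∈ Λ then
                  ((Matrix.reindex e e ((elimT 2 (fun _ : Fin 3 => N))ᵀ * reDelK n hn (fun _ : Fin 3 => N) * elimT 2 (fun _ : Fin 3 => N)))⁻¹ : Matrix ↥Λ ↥Λ ℝ) ⟨x, h.1⟩ ⟨y, h.2⟩ else 0)).map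
            (fun (z : B1Eq324BenfattoLemma.Site (3 + 3 + 1) → ℝ) (b : ↥(freeT 2 (fun _ : Fin 3 => N))) =>
              z ((e b : ↥Λ) : B1Eq324BenfattoLemma.Site (3 + 3 + 1))) =
          gaussianFieldOfKernel fun b b' =>
            ((((elimT 2 (fun _ : Fin 3 => N))ᵀ * reDelK n hn (fun _ : Fin 3 => N) * elimT 2 (fun _ : Fin 3 => N)))⁻¹ : Matrix ↥(freeT 2 (fun _ : Fin 3 => N)) ↥(freeT 2 (fun _ : Fin 3 => N)) ℝ) b b') ∧
        (∀ p : ℝ, 0 ≤ p →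
          ((fun (z : B1Eq324BenfattoLemma.Site (3 + 3 + 1) → ℝ) (b : ↥(freeT 2 (fun _ : Fin 3 => N))) =>
              z ((e b : ↥Λ) : B1Eq324BenfattoLemma.Site (3 + 3 + 1))) ⁻¹' {ω | ∀ b, |ω b| ≤ p}) =ᵐ[gaussianFieldOfKernel (fun x y => if h : x ∈ Λ ∧ y ∈ Λ then
                  ((Matrix.reindex e e ((elimT 2 (fun _ : Fin 3 => N))ᵀ * reDelK n hn (fun _ : Fin 3 => N) * elimT 2 (fun _ : Fin 3 => N)))⁻¹ : Matrix ↥Λ ↥Λ ℝ) ⟨x, h.1⟩ ⟨y, h.2⟩ else 0)]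
            smallFieldSet Λ p) ∧
        ∀ η : ℝ, 0 < η → η ≤ 1 →
          ∀ (s : ℕ) (I J : Finset (B1Eq324BenfattoLemma.Site (3 + 3 + 1))) (a : Coef (3 + 3 + 1)), I.Nonempty → J ⊆ I → J ⊆ Λ →
            coefSup s 4 a J ≤ 1 * η ^ (1 / 2 : ℝ) →
            0 < ∫ z, cutoffBoltzmann (hamiltonian s 4 1 a J) I (B10.pFun b₀ 1 η) z ∂(gaussianFieldOfKernel (fun x y => if h : x ∈ Λ ∧ y ∈ Λ then
                  ((Matrix.reindex e e ((elimT 2 (fun _ : Fin 3 => N))ᵀ * reDelK n hn (fun _ : Fin 3 => N) * elimT 2 (fun _ : Fin 3 => N)))⁻¹ : Matrix ↥Λ ↥Λ ℝ) ⟨x, h.1⟩ ⟨y, h.2⟩ else 0)) ∧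
              |Real.log (∫ z, cutoffBoltzmann (hamiltonian s 4 1 a J) I (B10.pFun b₀ 1 η) z ∂(gaussianFieldOfKernel (fun x y => if h : x ∈ Λ ∧ y ∈ Λ then
                  ((Matrix.reindex e e ((elimT 2 (fun _ : Fin 3 => N))ᵀ * reDelK n hn (fun _ : Fin 3 => N) * elimT 2 (fun _ : Fin 3 => N)))⁻¹ : Matrix ↥Λ ↥Λ ℝ) ⟨x, h.1⟩ ⟨y, h.2⟩ else 0))) -
                  cumulantSum (gaussianFieldOfKernel (fun x y => if h : x ∈ Λ ∧ y ∈ Λ then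
                  ((Matrix.reindex e e ((elimT 2 (fun _ : Fin 3 => N))ᵀ * reDelK n hn (fun _ : Fin 3 => N) * elimT 2 (fun _ : Fin 3 => N)))⁻¹ : Matrix ↥Λ ↥Λ ℝ) ⟨x, h.1⟩ ⟨y, h.2⟩ else 0)) (hamiltonian s 4 1 a J) 6| ≤ C * η ^ (13 / 4 : ℝ) * I.card :=
  eq324_torusGaugeFluctuation_on_unit (d := 3) (L := 2) (by norm_num) (by norm_num) 6 4 one_pos
    (by norm_num) (by norm_num) zero_le_one (by norm_num) (by norm_num)

end Literature.MathematicalPhysics.QuantumFieldTheory.Balaban1983to89.B1Eq324BenfattoClassTorusGaugeFluctuation
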